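/-
Copyright (c) 2026 the pub-hodgecm-mathlib formalisation cell (harness21).  Prover seat hodgecm-mathlib-K2E4-p10 (g7), Track B ∕ K2-LIT, h413 = `stmt-HodgeConjecture-24833`,
line `K2_E1_TraceFormulaBeta`, 5Res ROADCARD «ENDGAME BY FAMILIES» §3′ M2 v2 (K2E1-plan (g7), (181)∕(204)∕(207)) file D4′c (SD) part 1: the OPERATOR edition of ★ T5a
`K2E1PseudoEisensteinPlancherelIsometry` (vector-valued transforms, operator-valued axis datum) + the `⊕`-isometry packaging over ★ P3a `K2E1PlancherelIsometryOfForm`.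
-/
import Summits.HodgeConjecture.HodgeConjecture.Theorems.K2E1PseudoEisensteinPlancherelIsometry   -- ★ T5a p859878 (K2E1-p12): `integral_eq_setIntegral_Ioi_add_comp_neg`; brings ★ A `conj_vertical`
import Summits.HodgeConjecture.HodgeConjecture.Theorems.K2E1PlancherelIsometryOfForm            -- ★ P3a p859954 (K2E4-p23): `exists_linearIsometry_of_inner_eq_add`, `range_linearIsometry_eq_topologicalClosure_span`
import Mathlib.MeasureTheory.Function.L2Space
import HarnessLib

/-!
# D4′c (SD) part 1 — `K2E1PseudoEisensteinPlancherelIsometryOperator`: the unitary-axis two-term inner product formula with an OPERATOR-valued axis datum as the Hermitian form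
# `⟪Uθ, Uθ′⟫` on `M₁ ⊕ L²((0,∞); V)`, and the resulting Plancherel isometry (family-generic, Mathlib-only)

Track B ∕ K2-LIT, crux h413 = `stmt-HodgeConjecture-24833`, route of record `HCCMUnconditional`; cell `hodgecm-mathlib`, squad K2, ENGINE E1.  THEOREMS ONLY (no `def`, no `instance`,
no `notation`, no named-fact hypothesis, no `sorry`; default heartbeats); lane `--supports stmt-HodgeConjecture-24833 --as helper` (count-neutral).  No automorphic object.
THE MATHEMATICS ([MoeglinWaldspurger1995, II.2.4, IV.3.12 (b)]; [Iwaniec2002, §7.3]; [Langlands1976, §7]; [ReedSimonI1980, Thm. I.7]).  For a SELF-DUAL `χ`-family at a `K`-type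
`(K′, ω)` the section space `V = V(χ, K′, ω)` is finite-dimensional of dimension `> 1` at deep level, the transforms `Ψ̂(z) ∈ V` are VECTOR-valued and the intertwining datum `M(z;χ) ∈ End V` is
OPERATOR-valued: after the contour shift the inner product of two pseudo-Eisenstein series reads
`⟪θ′, θ⟫ = D + C·k·∫_ℝ ( ⟪A′(t), A(t)⟫_V + ⟪A′(−t), c(t) A(t)⟫_V ) dt`, `A(t) = Ψ̂(−(½+it))`, `c(t) = M(½+it)`, `D` the (finite) residue block.  ★ T5a treats the SCALAR case
`dim V = 1` (`|c| = 1`, `c(−t) = conj c(t)`).  The operator case needs exactly two axis identities — **(hc1)** `⟪c(t)x, c(t)y⟫ = ⟪x, y⟫` (UNITARITY of `M(½+it)`: functional equation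
`M(1−z)M(z) = 1` ∘ conjugation symmetry `M(z̄) = M(z)*`) and **(hcs)** `⟪x, c(t)y⟫ = ⟪c(−t)x, y⟫` (`M(½−it) = M(½+it)*`) — under which the same pointwise rearrangement holds (§1):
`⟪A′(t) + c(−t)A′(−t), A(t) + c(−t)A(−t)⟫ = G(t) + G(−t)`, `G(t) := ⟪A′(t), A(t)⟫ + ⟪A′(−t), c(t)A(t)⟫`; folding `∫_ℝ G = ∫_0^∞ (G(t) + G(−t))` (★ T5a §1) gives
`∫_ℝ G = ∫_0^∞ ⟪U′(t), U(t)⟫ dt`, `U(t) = A(t) + c(−t)A(−t)` (§2), i.e. the axis term is the inner product of `U′, U` in `L²((0,∞); V)` (§4).  Hence (§5) for any family `x_i` in a Hilbert space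
`H` (E1: the classes `[θ_{Ψ_i}] ∈ L²(X,μ)`) whose Gram form is `⟪x_i, x_j⟫ = ⟪r_i, r_j⟫_{M₁} + κ·∫_ℝ G_{ij}` (`r_i` = residue model vectors in any Hilbert space `M₁`, `κ ≥ 0`), ★ P3a's `⊕`-edition
yields a LINEAR ISOMETRY `U : closure span {x_i} →ₗᵢ M₁ ⊕₂ L²((0,∞); V)`, `U x_i = (r_i, √κ·[U_i])`, onto `closure span {(r_i, √κ·[U_i])}` — the (SD) block of ROADCARD §3′ D4′c:
`Θ_χ^{(K′,ω)} ≅ (⊕_j Res_{χ,j}) ⊕ 𝓜_χ^{cont}`, `𝓜^{cont} ⊂ L²(ℝ_{≥0}; V)`.  `c(t)` need not be linear for §1–§3 (only additivity of `⟪·,·⟫` is used); `V` any complex inner-product space.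
* §1 `hermitian_rearrangement_op`.  * §2 `axisPairing_eq_setIntegral_Ioi_op`, `axis_integrand_eq_op` (the f3-shaped integrand `⟪Ψ(−(1−z̄)), Φ(−z)⟫ + ⟪Ψ(−z̄), s(z)Φ(−z)⟫` at `z = ½+iy`).
* §3 HEAD-op **`plancherelForm_of_innerProductFormula_op`** (residue block `D` carried verbatim; T5a's `_finset` shape is the case `D = C·Σ_j …`).
* §4 `inner_eq_setIntegral_inner` (`⟪u′, u⟫_{L²(S;V)} = ∫_S ⟪U′, U⟫_V` for representatives).
* §5 **`exists_linearIsometry_of_twoTerm_gram`** (the `⊕`-isometry from the two-term Gram letter in axis currency) + `range` clause.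
HONEST LABEL: HC_CM is proved only modulo the 7 printed citations (2 remaining named inputs: hLiu418 = `stmt-HodgeConjecture-24832`, h413 = `stmt-HodgeConjecture-24833`) until rung 0
closes; this file asserts no named fact, closes no socket; count-neutral; letters at instantiation: the two-term Gram identity (H-χ (SD) ∘ C4 contour shift), (hc1)∕(hcs) (C3 matrix FE +
conjugation symmetry on the axis), integrability of the axis integrands.

## References
* [MoeglinWaldspurger1995] C. Mœglin, J.-L. Waldspurger, *Spectral decomposition and Eisenstein series* (1995), II.2.4, IV.3.12.
* [Iwaniec2002] H. Iwaniec, *Spectral Methods of Automorphic Forms* (2nd ed., 2002), §7.3.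
* [Langlands1976] R. P. Langlands, *On the Functional Equations Satisfied by Eisenstein Series*, LNM 544 (1976), §7.
* [ReedSimonI1980] M. Reed, B. Simon, *Methods of Modern Mathematical Physics I* (1980), Thm. I.7, §II.3.
-/

set_option autoImplicit false
set_option linter.dupNamespace false  -- the mandated namespace repeats the summit's segment (`HodgeConjecture.HodgeConjecture`)

noncomputable section

open MeasureTheory Measure Set Filter Topology Complex
open scoped Real ComplexConjugate InnerProductSpace
open Summit.HodgeConjecture.HodgeConjecture.Cruxes.H413.K2E1MellinPaleyWienerHalfLine (conj_vertical)
open Summit.HodgeConjecture.HodgeConjecture.Cruxes.H413.K2E1PseudoEisensteinPlancherelIsometry (integral_eq_setIntegral_Ioi_add_comp_neg)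
open Summit.HodgeConjecture.HodgeConjecture.Cruxes.H413.K2E1PlancherelIsometryOfForm (exists_linearIsometry_of_inner_eq exists_linearIsometry_of_inner_eq_add
  range_linearIsometry_eq_topologicalClosure_span mem_topologicalClosure_span)

namespace Summit.HodgeConjecture.HodgeConjecture.Cruxes.H413.K2E1PseudoEisensteinPlancherelIsometryOperator

variable {V : Type*} [NormedAddCommGroup V] [InnerProductSpace ℂ V]

/-! ## §1 The pointwise Hermitian rearrangement under a unitary, adjoint-reflection-symmetric operator datum -/

/-- **`⟪A′(t) + c(−t)A′(−t), A(t) + c(−t)A(−t)⟫ = G(t) + G(−t)`**, `G(t) = ⟪A′(t), A(t)⟫ + ⟪A′(−t), c(t)A(t)⟫`, when `c(t)` preserves inner products (hc1) and `c(−t)` is adjoint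
to `c(t)` (hcs).  (Expand; `⟪c(−t)x, c(−t)y⟫ = ⟪x, y⟫`; `⟪c(−t)A′(−t), A(t)⟫ = ⟪A′(−t), c(t)A(t)⟫`.)  The scalar case is ★ T5a `hermitian_rearrangement`.
[cite: MoeglinWaldspurger1995, IV.3.12] [cite: Iwaniec2002, §7.3] -/
theorem hermitian_rearrangement_op {A A' : ℝ → V} {c : ℝ → V → V}
    (hc1 : ∀ (t : ℝ) (x y : V), ⟪c t x, c t y⟫_ℂ = ⟪x, y⟫_ℂ) (hcs : ∀ (t : ℝ) (x y : V), ⟪x, c t y⟫_ℂ = ⟪c (-t) x, y⟫_ℂ) (t : ℝ) :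
    ⟪A' t + c (-t) (A' (-t)), A t + c (-t) (A (-t))⟫_ℂ =
      (⟪A' t, A t⟫_ℂ + ⟪A' (-t), c t (A t)⟫_ℂ) + (⟪A' (-t), A (-t)⟫_ℂ + ⟪A' (- -t), c (-t) (A (-t))⟫_ℂ) := by
  rw [inner_add_left, inner_add_right, inner_add_right, hc1 (-t), ← hcs t (A' (-t)) (A t), neg_neg]
  ring

/-! ## §2 The axis pairing as a half-line Hermitian integral -/

/-- **`∫_ℝ (⟪A′, A⟫ + ⟪A′(−·), c A⟫) = ∫_0^∞ ⟪A′(t) + c(−t)A′(−t), A(t) + c(−t)A(−t)⟫ dt`** for a unitary, adjoint-reflection-symmetric operator datum and an integrable integrand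
(★ T5a §1 fold, then §1 pointwise on `(0,∞)`). [cite: MoeglinWaldspurger1995, IV.3.12] [cite: Iwaniec2002, §7.3] -/
theorem axisPairing_eq_setIntegral_Ioi_op {A A' : ℝ → V} {c : ℝ → V → V}
    (hc1 : ∀ (t : ℝ) (x y : V), ⟪c t x, c t y⟫_ℂ = ⟪x, y⟫_ℂ) (hcs : ∀ (t : ℝ) (x y : V), ⟪x, c t y⟫_ℂ = ⟪c (-t) x, y⟫_ℂ)
    (hG : Integrable fun t : ℝ => ⟪A' t, A t⟫_ℂ + ⟪A' (-t), c t (A t)⟫_ℂ) :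
    ∫ t : ℝ, (⟪A' t, A t⟫_ℂ + ⟪A' (-t), c t (A t)⟫_ℂ) = ∫ t in Ioi (0 : ℝ), ⟪A' t + c (-t) (A' (-t)), A t + c (-t) (A (-t))⟫_ℂ := by
  rw [integral_eq_setIntegral_Ioi_add_comp_neg hG]
  refine setIntegral_congr_fun measurableSet_Ioi fun t _ => ?_
  rw [hermitian_rearrangement_op hc1 hcs t, neg_neg]

/-- On the axis `z = ½ + iy`: the f3-shaped VECTOR integrand `⟪Ψ(−(1−z̄)), Φ(−z)⟫ + ⟪Ψ(−z̄), s(z)Φ(−z)⟫` is `⟪A′(y), A(y)⟫ + ⟪A′(−y), c(y)A(y)⟫` with `A = Φ(−(½+i·))`,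
`A′ = Ψ(−(½+i·))`, `c = s(½+i·)` (`1 − z̄ = z`, `z̄ = ½ + i(−y)`; scalar twin ★ T5a `axis_integrand_eq`). [folklore] -/
theorem axis_integrand_eq_op (Φ Ψ : ℂ → V) (s : ℂ → V → V) (y : ℝ) :
    ⟪Ψ (-(1 - conj ((((1 / 2 : ℝ)) : ℂ) + y * I))), Φ (-((((1 / 2 : ℝ)) : ℂ) + y * I))⟫_ℂ +
        ⟪Ψ (-conj ((((1 / 2 : ℝ)) : ℂ) + y * I)), s ((((1 / 2 : ℝ)) : ℂ) + y * I) (Φ (-((((1 / 2 : ℝ)) : ℂ) + y * I)))⟫_ℂ =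
      ⟪Ψ (-((((1 / 2 : ℝ)) : ℂ) + y * I)), Φ (-((((1 / 2 : ℝ)) : ℂ) + y * I))⟫_ℂ +
        ⟪Ψ (-((((1 / 2 : ℝ)) : ℂ) + ((-y : ℝ) : ℂ) * I)), s ((((1 / 2 : ℝ)) : ℂ) + y * I) (Φ (-((((1 / 2 : ℝ)) : ℂ) + y * I)))⟫_ℂ := by
  have h1 : 1 - conj ((((1 / 2 : ℝ)) : ℂ) + y * I) = (((1 / 2 : ℝ)) : ℂ) + y * I := by
    rw [conj_vertical]
    apply Complex.ext
    · norm_num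
    · norm_num
  rw [h1, conj_vertical]

/-! ## §3 HEAD-op: the two-term formula in `⟪Uθ′, Uθ⟫` form (operator datum; residue block carried verbatim) -/

/-- **HEAD-op — THE PLANCHEREL FORM OF THE UNITARY-AXIS INNER PRODUCT FORMULA WITH AN OPERATOR-VALUED AXIS DATUM.**  Data: vector transforms `Φ, Ψ : ℂ → V`, axis operators
`s : ℂ → V → V`, constants `C, k : ℂ`, a residue block `D : ℂ` (carried verbatim — ★ T5a's `_finset` shape is `D = C·Σ_{j∈J} ρ_j …`), and a number `IP` with the f3-shaped identity
**(hIP)** `IP = D + C·(k·∫_ℝ (⟪Ψ(−(1−z̄)), Φ(−z)⟫ + ⟪Ψ(−z̄), s(z)Φ(−z)⟫) dy)`, `z = ½+iy`; the axis operators UNITARY **(hs1)** `⟪s(½+it)x, s(½+it)y⟫ = ⟪x, y⟫` and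
ADJOINT-REFLECTION-SYMMETRIC **(hss)** `⟪x, s(½+it)y⟫ = ⟪s(½−it)x, y⟫`; the axis integrand integrable **(hG)**.  THEN
**`IP = D + C·(k·∫_0^∞ ⟪U′(t), U(t)⟫ dt)`**, `U(t) = Φ(−(½+it)) + s(½−it)Φ(−(½−it))`, `U′` likewise from `Ψ`.
[cite: MoeglinWaldspurger1995, II.2.4, IV.3.12] [cite: Iwaniec2002, §7.3] [cite: Langlands1976, §7] -/
theorem plancherelForm_of_innerProductFormula_op (Φ Ψ : ℂ → V) (s : ℂ → V → V) {IP D C k : ℂ}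
    (hIP : IP = D + C * (k * ∫ y : ℝ, (⟪Ψ (-(1 - conj ((((1 / 2 : ℝ)) : ℂ) + y * I))), Φ (-((((1 / 2 : ℝ)) : ℂ) + y * I))⟫_ℂ +
        ⟪Ψ (-conj ((((1 / 2 : ℝ)) : ℂ) + y * I)), s ((((1 / 2 : ℝ)) : ℂ) + y * I) (Φ (-((((1 / 2 : ℝ)) : ℂ) + y * I)))⟫_ℂ)))
    (hs1 : ∀ (t : ℝ) (x y : V), ⟪s ((((1 / 2 : ℝ)) : ℂ) + t * I) x, s ((((1 / 2 : ℝ)) : ℂ) + t * I) y⟫_ℂ = ⟪x, y⟫_ℂ)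
    (hss : ∀ (t : ℝ) (x y : V), ⟪x, s ((((1 / 2 : ℝ)) : ℂ) + t * I) y⟫_ℂ = ⟪s ((((1 / 2 : ℝ)) : ℂ) + ((-t : ℝ) : ℂ) * I) x, y⟫_ℂ)
    (hG : Integrable fun y : ℝ => ⟪Ψ (-(1 - conj ((((1 / 2 : ℝ)) : ℂ) + y * I))), Φ (-((((1 / 2 : ℝ)) : ℂ) + y * I))⟫_ℂ +
        ⟪Ψ (-conj ((((1 / 2 : ℝ)) : ℂ) + y * I)), s ((((1 / 2 : ℝ)) : ℂ) + y * I) (Φ (-((((1 / 2 : ℝ)) : ℂ) + y * I)))⟫_ℂ) :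
    IP = D + C * (k * ∫ t in Ioi (0 : ℝ),
      ⟪Ψ (-((((1 / 2 : ℝ)) : ℂ) + t * I)) + s ((((1 / 2 : ℝ)) : ℂ) + ((-t : ℝ) : ℂ) * I) (Ψ (-((((1 / 2 : ℝ)) : ℂ) + ((-t : ℝ) : ℂ) * I))),
        Φ (-((((1 / 2 : ℝ)) : ℂ) + t * I)) + s ((((1 / 2 : ℝ)) : ℂ) + ((-t : ℝ) : ℂ) * I) (Φ (-((((1 / 2 : ℝ)) : ℂ) + ((-t : ℝ) : ℂ) * I)))⟫_ℂ) := by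
  set A : ℝ → V := fun t => Φ (-((((1 / 2 : ℝ)) : ℂ) + t * I)) with hA
  set A' : ℝ → V := fun t => Ψ (-((((1 / 2 : ℝ)) : ℂ) + t * I)) with hA'
  set c : ℝ → V → V := fun t => s ((((1 / 2 : ℝ)) : ℂ) + t * I) with hc
  have hint : (fun y : ℝ => ⟪Ψ (-(1 - conj ((((1 / 2 : ℝ)) : ℂ) + y * I))), Φ (-((((1 / 2 : ℝ)) : ℂ) + y * I))⟫_ℂ +
        ⟪Ψ (-conj ((((1 / 2 : ℝ)) : ℂ) + y * I)), s ((((1 / 2 : ℝ)) : ℂ) + y * I) (Φ (-((((1 / 2 : ℝ)) : ℂ) + y * I)))⟫_ℂ) =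
      fun y : ℝ => ⟪A' y, A y⟫_ℂ + ⟪A' (-y), c y (A y)⟫_ℂ := by
    funext y
    rw [axis_integrand_eq_op]
  have hG' : Integrable fun y : ℝ => ⟪A' y, A y⟫_ℂ + ⟪A' (-y), c y (A y)⟫_ℂ := by rw [← hint]; exact hG
  have hcs : ∀ (t : ℝ) (x y : V), ⟪x, c t y⟫_ℂ = ⟪c (-t) x, y⟫_ℂ := fun t x y => hss t x y
  rw [hIP, hint, axisPairing_eq_setIntegral_Ioi_op (fun t => hs1 t) hcs hG']

/-! ## §4 The `L²(S; V)` inner product of two representatives -/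

/-- **`⟪u′, u⟫_{L²(μ;V)} = ∫ ⟪U′, U⟫_V dμ`** for `L²` representatives `u =ᵐ U`, `u′ =ᵐ U′` (Mathlib `L2.inner_def`). [folklore] -/
theorem inner_eq_integral_inner {α : Type*} [MeasurableSpace α] {μ : Measure α} (u' u : Lp V 2 μ) {U' U : α → V}
    (hu' : (u' : α → V) =ᵐ[μ] U') (hu : (u : α → V) =ᵐ[μ] U) : ⟪u', u⟫_ℂ = ∫ a, ⟪U' a, U a⟫_ℂ ∂μ := by
  rw [L2.inner_def]
  refine integral_congr_ae ?_
  filter_upwards [hu, hu'] with a ha ha'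
  rw [ha, ha']

/-! ## §5 The `⊕`-isometry from the two-term Gram letter (operator datum) -/

/-- **THE PLANCHEREL ISOMETRY OF A SELF-DUAL BLOCK FROM ITS TWO-TERM GRAM FORMULA (operator datum).**  Data: a family `x : ι → H` in a complex inner-product space (E1: the classes
`[θ_{Ψ_i}] ∈ L²(X, μ)` of a self-dual `χ`-family at a `K`-type), residue model vectors `r : ι → M₁` (any complete inner-product space; E1: `⊕_j Res_{χ,j}`), axis vectors `A_i : ℝ → V`
(`A_i(t) = Ψ̂_i(−(½+it))`), an operator datum `c : ℝ → V → V` unitary (hc1) and adjoint-reflection-symmetric (hcs), a constant `κ ≥ 0`, and `L²((0,∞); V)`-representatives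
`w_i =ᵐ U_i`, `U_i(t) = A_i(t) + c(−t)A_i(−t)`.  HYPOTHESIS (the two-term Gram letter in axis currency, H-χ (SD) ∘ contour shift):
`hGram : ⟪x_i, x_j⟫ = ⟪r_i, r_j⟫ + κ·∫_ℝ (⟪A_i(t), A_j(t)⟫ + ⟪A_i(−t), c(t)A_j(t)⟫) dt` with integrable integrands.  THEN there is a LINEAR ISOMETRY
**`U : closure span {x_i} →ₗᵢ[ℂ] M₁ ⊕₂ L²((0,∞); V)` with `U x_i = (r_i, √κ • w_i)`** — the block is isometric to (residues) ⊕ (continuous Mellin model) — by §2, §4 and ★ P3a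
`exists_linearIsometry_of_inner_eq_add`. [cite: MoeglinWaldspurger1995, II.2.4, IV.3.12] [cite: ReedSimonI1980, Thm. I.7] -/
theorem exists_linearIsometry_of_twoTerm_gram {H : Type*} [NormedAddCommGroup H] [InnerProductSpace ℂ H] {M₁ : Type*} [NormedAddCommGroup M₁] [InnerProductSpace ℂ M₁] [CompleteSpace M₁]
    [CompleteSpace V] {ι : Type*} (x : ι → H) (r : ι → M₁) (A : ι → ℝ → V) {c : ℝ → V → V}
    (hc1 : ∀ (t : ℝ) (v v' : V), ⟪c t v, c t v'⟫_ℂ = ⟪v, v'⟫_ℂ) (hcs : ∀ (t : ℝ) (v v' : V), ⟪v, c t v'⟫_ℂ = ⟪c (-t) v, v'⟫_ℂ)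
    {κ : ℝ} (hκ : 0 ≤ κ) (w : ι → Lp V 2 ((volume : Measure ℝ).restrict (Ioi 0)))
    (hw : ∀ i, (w i : ℝ → V) =ᵐ[(volume : Measure ℝ).restrict (Ioi 0)] fun t => A i t + c (-t) (A i (-t)))
    (hG : ∀ i j, Integrable fun t : ℝ => ⟪A i t, A j t⟫_ℂ + ⟪A i (-t), c t (A j t)⟫_ℂ)
    (hGram : ∀ i j, ⟪x i, x j⟫_ℂ = ⟪r i, r j⟫_ℂ + (κ : ℂ) * ∫ t : ℝ, (⟪A i t, A j t⟫_ℂ + ⟪A i (-t), c t (A j t)⟫_ℂ)) :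
    ∃ U : (Submodule.span ℂ (Set.range x)).topologicalClosure →ₗᵢ[ℂ] WithLp 2 (M₁ × Lp V 2 ((volume : Measure ℝ).restrict (Ioi 0))),
      ∀ i, U ⟨x i, mem_topologicalClosure_span x i⟩ = WithLp.toLp 2 (r i, ((Real.sqrt κ : ℝ) : ℂ) • w i) := by
  have hκ2 : ((Real.sqrt κ : ℝ) : ℂ) * ((Real.sqrt κ : ℝ) : ℂ) = (κ : ℂ) := by
    rw [← ofReal_mul, Real.mul_self_sqrt hκ]
  have hG2 : ∀ i j, ⟪x i, x j⟫_ℂ = ⟪r i, r j⟫_ℂ + ⟪((Real.sqrt κ : ℝ) : ℂ) • w i, ((Real.sqrt κ : ℝ) : ℂ) • w j⟫_ℂ := fun i j => by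
    have h4 : ⟪w i, w j⟫_ℂ = _ := inner_eq_integral_inner (w i) (w j) (hw i) (hw j)
    rw [hGram i j, inner_smul_left, inner_smul_right, conj_ofReal, ← mul_assoc, hκ2, h4, axisPairing_eq_setIntegral_Ioi_op hc1 hcs (hG i j)]
  exact exists_linearIsometry_of_inner_eq_add (H := H) (x := x) r (fun i => ((Real.sqrt κ : ℝ) : ℂ) • w i) hG2

/-- **RANGE of the `⊕`-isometry** (`H` complete): `range U = closure span {(r_i, √κ • w_i)}` (★ P3a `range_linearIsometry_eq_topologicalClosure_span`). [cite: ReedSimonI1980, Thm. I.7] -/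
theorem range_linearIsometry_of_twoTerm_gram {H : Type*} [NormedAddCommGroup H] [InnerProductSpace ℂ H] [CompleteSpace H] {M₁ : Type*} [NormedAddCommGroup M₁] [InnerProductSpace ℂ M₁]
    {ι : Type*} (x : ι → H) (r : ι → M₁) {κ : ℝ} (w : ι → Lp V 2 ((volume : Measure ℝ).restrict (Ioi 0)))
    (U : (Submodule.span ℂ (Set.range x)).topologicalClosure →ₗᵢ[ℂ] WithLp 2 (M₁ × Lp V 2 ((volume : Measure ℝ).restrict (Ioi 0))))
    (hU : ∀ i, U ⟨x i, mem_topologicalClosure_span x i⟩ = WithLp.toLp 2 (r i, ((Real.sqrt κ : ℝ) : ℂ) • w i)) :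
    Set.range U = ((Submodule.span ℂ (Set.range fun i => WithLp.toLp 2 (r i, ((Real.sqrt κ : ℝ) : ℂ) • w i))).topologicalClosure :
      Set (WithLp 2 (M₁ × Lp V 2 ((volume : Measure ℝ).restrict (Ioi 0))))) :=
  range_linearIsometry_eq_topologicalClosure_span (H := H) (x := x) (u := fun i => WithLp.toLp 2 (r i, ((Real.sqrt κ : ℝ) : ℂ) • w i)) U hU

end Summit.HodgeConjecture.HodgeConjecture.Cruxes.H413.K2E1PseudoEisensteinPlancherelIsometryOperator

end
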